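/-
Copyright (c) 2026. All rights reserved.
Released under Apache 2.0 license as described in the file LICENSE.
Authors: abc-iut cell, seat abc-iut-w6-d023 (gen 3; block C / W6).
-/
import Literature.AnabelianGeometry.AbsoluteAnabelian.AbsTopIII.FrobeniusPictureMLFCompatTwistedToyShift
import Literature.AnabelianGeometry.AbsoluteAnabelian.AbsTopIII.FrobeniusPictureMLFLogTeleBoundary
import Literature.AnabelianGeometry.AbsoluteAnabelian.DiagramUniversalTelecores
import Literature.AnabelianGeometry.AbsoluteAnabelian.DiagramTelecores
import HarnessLib

/-!
# [AbsTopIII] Cor. 3.6 (ii)/(iii) at the twisted toy datum, I: the telecore `𝔗_An` of the printed shape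
# over the TWISTED core `(𝒟_{≤5}, Anab)`

S. Mochizuki, *Topics in Absolute Anabelian Geometry III* [MochizukiAbsTopIII2015] (kurims `paper:url-5493eb38cbb7`):
Cor. 3.6 (ii) p. 79 l. 40–41 ("`φ_An` gives rise to a telecore structure `𝔗_An` on `𝒟_{≤4}` … by appending to
`𝒟_{≤5}` telecore edges" `φ_⋏`, `⋏ ∈ L†`), Def. 3.5 (iv) p. 76 (telecores: `𝒥|_𝒮 = ℋ`, boundary set = the pairs
`([γ₃]∘[γ₁], [γ₃]∘[γ₂])` through `v_𝒮`), Cor. 3.6 (iii) p. 80 (the `𝔖_log` family "is compatible with the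
families of homotopies that constitute the core and telecore structures of (i), (ii)").

Third file of the twisted-toy separation (this seat: `FrobeniusPictureMLFCompatTwistedToy` — the literal (iii)
CORES clause holds at `TwistedToy.datum` while F-0360 `IotaOverGaloisStmt` fails; `…TwistedToyShift` — so does the
(v) third sentence).  For the remaining typed clause, the TELECORE half `LogObsCompatTelecoreStmt τ`
(abc-iut-L4-t5: over SOME core structure on `(𝒟_{≤5}, Anab)`, a telecore of the printed shape and ONE family on
its diagram `𝒟_An` containing the telecore family `𝒥` and, along `𝒟_{≤3} ↪ 𝒟_An`, the `𝔖_log` family), this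
file builds, on the telecore diagram `𝒟_An = datum.teleDiagram anJ (datum.anTelMap τ)` of the toy (telecore
edges `φ_⋏` carrying `φ_An = 𝟭` at `□` and `τ.φ₁` on the first row — ANY telecore datum `τ`; `τ.φ₁` preserves
underlying elements because `η₁ : … ⋙ φ₁ ≅ 𝟭` is natural in the commutative group `ℤ/2`):

* `TwistedToy.tval` / `tofVal`, `tEdgeWt` / `tPathWt` — underlying elements and `λ^{×pf}`-counts on `𝒟_An`;
* `TwistedToy.tEta`, `TwistedToy.tFamily E hE` — the twisted homotopies `g ^ (wt γ₂ − wt γ₁)` form a family of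
  homotopies on `𝒟_An` for EVERY saturated boundary set `E` (Def. 3.5 (ii) laws proved);
* `TwistedToy.jfam`, **`TwistedToy.telecore τ`** — the telecore `𝔗_An` of the printed shape
  (`telecore_isTelecoreAn`) over the TWISTED core family `coreFamily5Of family` of the first file: `𝒥` = the
  twisted family on the pairs through `Anab`; `𝒥|_𝒮 = ℋ` heterogeneously along `𝒟_{≤5} ∪ {Anab} ↪ 𝒟_An`
  (abc-iut-L4-t5's `pathFunctor_telecoreInclusion`, `eq_obs_of_mapPath_eq_comp`).

The sequel `FrobeniusPictureMLFCompatTwistedToyTeleFamily` adds the master family on `𝒟_An` (boundary set =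
abc-iut-w6-d025's `TGlueE`) and concludes `LogObsCompatTelecoreStmt τ` at the toy.  HONEST FRAMING: bookkeeping
over the typed data and a toy datum (toy ≠ model); refereed pre-IUT material; nothing here bears on
[IUTchIII] Cor. 3.12 or takes a side; typed ≠ proved.
-/

namespace Literature.AnabelianGeometry.AbsoluteAnabelian

open _root_.CategoryTheory _root_.Quiver

namespace LogFrobeniusData

open DiagramOfCategories

namespace TwistedToy

variable (τ : datum.TelecoreData)

/-- The telecore diagram `𝒟_An` of the toy for the telecore datum `τ` (edges `φ_⋏`, `⋏ ∈ L†`).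
[cite: MochizukiAbsTopIII2015, Corollary 3.6 (ii) p.79] -/
abbrev TD := datum.teleDiagram anJ (datum.anTelMap τ)

/-! ### underlying elements on the telecore diagram -/

/-- `ofVal ∘ val = id` (as in the first file). [folklore] -/
private theorem ofVal_val' (v : LFVertex) {x y : datum.diagram.obj v} (f : x ⟶ y) : ofVal v x y (val v f) = f := by
  cases v <;> rfl

/-- `val ∘ ofVal = id`. [folklore] -/
private theorem val_ofVal' (v : LFVertex) (x y : datum.diagram.obj v) (g : Grp) : val v (ofVal v x y g) = g := by
  cases v <;> rfl

/-- A morphism of a vertex category of `𝒟` is determined by its underlying element. [folklore] -/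
private theorem val_injective' (v : LFVertex) {x y : datum.diagram.obj v} {f g : x ⟶ y}
    (h : val v f = val v g) : f = g := by
  rw [← ofVal_val' v f, ← ofVal_val' v g, h]

/-- Composition multiplies underlying elements. [folklore] -/
private theorem val_comp' (v : LFVertex) {x y z : datum.diagram.obj v} (f : x ⟶ y) (g : y ⟶ z) :
    val v (f ≫ g) = val v g * val v f := by
  cases v <;> rfl

/-- Identities have underlying element `1`. [folklore] -/
private theorem val_id' (v : LFVertex) (x : datum.diagram.obj v) : val v (𝟙 x) = 1 := by
  cases v <;> rfl

/-- Underlying element of a morphism of the category at a vertex of `𝒟_An` (`𝒟_{≤4}`: as in `𝒟`; `Anab = B(ℤ/2)`). [folklore] -/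
def tval : ∀ (v : (teleShape anJ.{0}).Vertex) {x y : (TD τ).obj v}, (x ⟶ y) → Grp
  | ExtVertex.base a, _, _, f => val a.1 f
  | ExtVertex.obs, _, _, f => f

/-- The morphism of a vertex category of `𝒟_An` with prescribed underlying element. [folklore] -/
def tofVal : ∀ (v : (teleShape anJ.{0}).Vertex) (x y : (TD τ).obj v), Grp → (x ⟶ y)
  | ExtVertex.base a, x, y, g => ofVal a.1 x y g
  | ExtVertex.obs, _, _, g => g

/-- `tval ∘ tofVal = id`. [folklore] -/
private theorem tval_tofVal (v : (teleShape anJ.{0}).Vertex) (x y : (TD τ).obj v) (g : Grp) :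
    tval τ v (tofVal τ v x y g) = g := by
  cases v with
  | base a => exact val_ofVal' a.1 x y g
  | obs => rfl

/-- `tofVal ∘ tval = id`. [folklore] -/
private theorem tofVal_tval (v : (teleShape anJ.{0}).Vertex) {x y : (TD τ).obj v} (f : x ⟶ y) :
    tofVal τ v x y (tval τ v f) = f := by
  cases v with
  | base a => exact ofVal_val' a.1 f
  | obs => rfl

/-- A morphism is determined by its underlying element. [folklore] -/
private theorem tval_injective (v : (teleShape anJ.{0}).Vertex) {x y : (TD τ).obj v} {f g : x ⟶ y}
    (h : tval τ v f = tval τ v g) : f = g := by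
  rw [← tofVal_tval τ v f, ← tofVal_tval τ v g, h]

/-- Composition multiplies underlying elements. [folklore] -/
private theorem tval_comp (v : (teleShape anJ.{0}).Vertex) {x y z : (TD τ).obj v} (f : x ⟶ y) (g : y ⟶ z) :
    tval τ v (f ≫ g) = tval τ v g * tval τ v f := by
  cases v with
  | base a => exact val_comp' a.1 f g
  | obs => rfl

/-- Identities have underlying element `1`. [folklore] -/
private theorem tval_id (v : (teleShape anJ.{0}).Vertex) (x : (TD τ).obj v) : tval τ v (𝟙 x) = 1 := by
  cases v with
  | base a => exact val_id' a.1 x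
  | obs => rfl

/-- `eqToHom`s have underlying element `1`. [folklore] -/
private theorem tval_eqToHom (v : (teleShape anJ.{0}).Vertex) {x y : (TD τ).obj v} (h : x = y) :
    tval τ v (eqToHom h) = 1 := by
  cases h; exact tval_id τ v x

/-- A functor between vertex categories of `𝒟_An` PRESERVES UNDERLYING ELEMENTS. [folklore] -/
private def TPreservesVal {a b : (teleShape anJ.{0}).Vertex} (F : (TD τ).obj a ⥤ (TD τ).obj b) : Prop :=
  ∀ ⦃x y : (TD τ).obj a⦄ (f : x ⟶ y), tval τ b (F.map f) = tval τ a f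

/-- The identity functor preserves underlying elements. [folklore] -/
private theorem tPreservesVal_id (a : (teleShape anJ.{0}).Vertex) : TPreservesVal τ (𝟭 ((TD τ).obj a)) :=
  fun _ _ _ => rfl

/-- Composites of element-preserving functors preserve elements. [folklore] -/
private theorem TPreservesVal.comp {a b c : (teleShape anJ.{0}).Vertex} {F : (TD τ).obj a ⥤ (TD τ).obj b}
    {G : (TD τ).obj b ⥤ (TD τ).obj c} (hF : TPreservesVal τ F) (hG : TPreservesVal τ G) :
    TPreservesVal τ (F ⋙ G) :=
  fun _ _ f => (hG (F.map f)).trans (hF f)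

/-- `φ_⋎ = τ.φ₁` preserves underlying elements: by the naturality of `η₁ : … ⋙ φ₁ ≅ 𝟭` in the
commutative group `ℤ/2`. [folklore] -/
private theorem val_φ₁_map {x y : Cat} (f : x ⟶ y) : @Eq Grp (τ.φ₁.map f) f := by
  have h : @Eq Grp (@HMul.hMul Grp Grp Grp _ (τ.η₁.hom.app y) (τ.φ₁.map f))
      (@HMul.hMul Grp Grp Grp _ f (τ.η₁.hom.app x)) := τ.η₁.hom.naturality f
  have hc : @Eq Grp (τ.η₁.hom.app x) (τ.η₁.hom.app y) := by cases x; cases y; rfl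
  rw [hc, mul_comm] at h
  exact mul_right_cancel h

/-- Every edge functor of `𝒟_An` — those of `𝒟_{≤4}`, `κ_An`, `φ_An`, `φ_⋎` — preserves underlying elements.
[cite: MochizukiAbsTopIII2015, Corollary 3.6 (ii) p.79] -/
private theorem tPreservesVal_map : ∀ {a b : (teleShape anJ.{0}).Vertex} (e : a ⟶ b),
    TPreservesVal τ ((TD τ).map e) := by
  intro a b e
  cases a with
  | obs =>
    cases b with
    | obs => exact PEmpty.elim e
    | base β =>
      obtain ⟨β, hβ⟩ := β
      cases β with
      | row1 n => intro x y f; exact val_φ₁_map τ f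
      | nexus => intro x y f; rfl
      | third => exact PEmpty.elim e
      | fourth => exact PEmpty.elim e
      | fifth => exact PEmpty.elim e
      | sixth => exact PEmpty.elim e
  | base α =>
    obtain ⟨α, hα⟩ := α
    cases b with
    | obs =>
      cases α with
      | fourth => intro x y f; rfl
      | row1 n => exact PEmpty.elim e
      | nexus => exact PEmpty.elim e
      | third => exact PEmpty.elim e
      | fifth => exact PEmpty.elim e
      | sixth => exact PEmpty.elim e
    | base β =>
      obtain ⟨β, hβ⟩ := β
      cases α <;> cases β <;>
        first
          | exact (PEmpty.elim e)
          | (intro x y f; rfl)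
          | (rcases e with ⟨_ | _⟩ <;> intro x y f <;> rfl)

/-- Every path functor of `𝒟_An` preserves underlying elements (Def. 3.5 (i)).
[cite: MochizukiAbsTopIII2015, Definition 3.5 (i) p.74] -/
private theorem tPreservesVal_pathFunctor {a b : (teleShape anJ.{0}).Vertex} (p : Path a b) :
    TPreservesVal τ ((TD τ).pathFunctor p) := by
  induction p with
  | nil => rw [pathFunctor_nil]; exact tPreservesVal_id τ a
  | cons p e ih => rw [pathFunctor_cons]; exact ih.comp τ (tPreservesVal_map τ e)

/-! ### weights on the telecore diagram -/

/-- Weight of an edge of `Γ⃗_{𝒟_An}`: the `𝒟`-weight (`1` on `λ^{×pf}`) on the edges of `𝒟_{≤4}`, `0` on `κ_An` and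
on the telecore edges. [cite: MochizukiAbsTopIII2015, Corollary 3.6 (ii) p.79] -/
def tEdgeWt : ∀ {a b : (teleShape anJ.{0}).Vertex}, (a ⟶ b) → ZMod 2
  | ExtVertex.base _, ExtVertex.base _, e => edgeWt e
  | ExtVertex.base _, ExtVertex.obs, _ => 0
  | ExtVertex.obs, ExtVertex.base _, _ => 0
  | ExtVertex.obs, ExtVertex.obs, _ => 0

/-- Weight of a path of `𝒟_An`: its number of `λ^{×pf}`-edges mod 2. [cite: MochizukiAbsTopIII2015, Corollary 3.6 (ii) p.79] -/
def tPathWt : ∀ {a b : (teleShape anJ.{0}).Vertex}, Path a b → ZMod 2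
  | _, _, .nil => 0
  | _, _, .cons p e => tPathWt p + tEdgeWt e

/-- The empty path has weight `0`. [cite: MochizukiAbsTopIII2015, Corollary 3.6 (ii) p.79] -/
@[simp] theorem tPathWt_nil (a : (teleShape anJ.{0}).Vertex) : tPathWt (Path.nil : Path a a) = 0 := by
  rw [tPathWt]

/-- Weight of an extended path. [cite: MochizukiAbsTopIII2015, Corollary 3.6 (ii) p.79] -/
@[simp] theorem tPathWt_cons {a b c : (teleShape anJ.{0}).Vertex} (p : Path a b) (e : b ⟶ c) :
    tPathWt (p.cons e) = tPathWt p + tEdgeWt e := by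
  rw [tPathWt]

/-- The weight is additive along composition. [cite: MochizukiAbsTopIII2015, Corollary 3.6 (ii) p.79] -/
theorem tPathWt_comp {a b c : (teleShape anJ.{0}).Vertex} (p : Path a b) (q : Path b c) :
    tPathWt (p.comp q) = tPathWt p + tPathWt q := by
  induction q with
  | nil => simp
  | cons q e ih => rw [Path.comp_cons, tPathWt_cons, tPathWt_cons, ih, add_assoc]

/-! ### the twisted homotopies and families on the telecore diagram -/

/-- **The twisted homotopy** of a co-verticial pair of `𝒟_An`: all components the central element
`g ^ (wt γ₂ − wt γ₁)` (natural: path functors preserve underlying elements, `ℤ/2` is commutative).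
[cite: MochizukiAbsTopIII2015, Definition 3.5 (ii) p.75] -/
def tEta {a b : (teleShape anJ.{0}).Vertex} (p q : Path a b) : (TD τ).pathFunctor p ⟶ (TD τ).pathFunctor q where
  app x := tofVal τ b _ _ (Multiplicative.ofAdd (tPathWt q - tPathWt p))
  naturality x y f := by
    apply tval_injective τ b
    rw [tval_comp, tval_comp, tval_tofVal, tval_tofVal, tPreservesVal_pathFunctor τ p f,
      tPreservesVal_pathFunctor τ q f]
    exact mul_comm _ _

/-- Underlying element of a component of the twisted homotopy. [folklore] -/
private theorem tval_tEta_app {a b : (teleShape anJ.{0}).Vertex} (p q : Path a b) (x : (TD τ).obj a) :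
    tval τ b ((tEta τ p q).app x) = Multiplicative.ofAdd (tPathWt q - tPathWt p) :=
  tval_tofVal τ b _ _ _

/-- **The twisted family of homotopies on `𝒟_An` with a prescribed saturated boundary set `E`** (Def. 3.5 (ii):
identity, composition and whiskering laws PROVED, for every `E`). [cite: MochizukiAbsTopIII2015, Definition 3.5 (ii) p.75] -/
def tFamily (E : ∀ ⦃a b : (teleShape anJ.{0}).Vertex⦄, Path a b → Path a b → Prop) (hE : IsSaturated E) :
    (TD τ).HomotopyFamily where
  E := E
  isSaturated := hE
  η := fun _ _ p q _ => tEta τ p q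
  η_refl := by
    intro a b p _
    ext x
    apply tval_injective τ b
    rw [tval_tEta_app, NatTrans.id_app, tval_id, sub_self, ofAdd_zero]
  η_trans := by
    intro a b p q r _ _
    ext x
    apply tval_injective τ b
    rw [NatTrans.comp_app, tval_comp, tval_tEta_app, tval_tEta_app, tval_tEta_app, ← ofAdd_add]
    congr 1
    ring
  η_whisker := by
    intro a b c d p q _ r₁ r₂
    ext x
    apply tval_injective τ d
    rw [tval_tEta_app, NatTrans.comp_app, NatTrans.comp_app, tval_comp, tval_comp, eqToHom_app,
      eqToHom_app, tval_eqToHom, tval_eqToHom, Functor.whiskerLeft_app, Functor.whiskerRight_app,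
      one_mul, mul_one]
    erw [tPreservesVal_pathFunctor τ r₂ ((tEta τ p q).app _)]
    rw [tval_tEta_app, tPathWt_comp, tPathWt_comp, tPathWt_comp, tPathWt_comp]
    congr 1
    ring

/-! ### the telecore `𝔗_An` over the TWISTED core `(𝒟_{≤5}, Anab)` -/

/-- Pairs through the core vertex: `univE {Anab}` unpacked (Def. 3.5 (iv) (b)). [cite: MochizukiAbsTopIII2015, Definition 3.5 (iv) p.76] -/
private theorem univE_obs_iff {a b : (teleShape anJ.{0}).Vertex} (P Q : Path a b) :
    univE (· = (teleShape anJ.{0}).obs) P Q ↔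
      ∃ (p₁ q₁ : Path a (teleShape anJ.{0}).obs) (r : Path (teleShape anJ.{0}).obs b),
        P = p₁.comp r ∧ Q = q₁.comp r := by
  constructor
  · rintro ⟨d⟩
    obtain ⟨w, hw, p, q, s, hp, hq⟩ := d
    subst hw
    exact ⟨p, q, s, hp, hq⟩
  · rintro ⟨p₁, q₁, r, hp, hq⟩
    exact ⟨⟨_, rfl, p₁, q₁, r, hp, hq⟩⟩

/-- No telecore edges in the shape of the observable `(𝒟_{≤5}, Anab)`. [folklore] -/
private theorem coreShape5_isEmpty_J'' : ∀ a, IsEmpty (coreShape5.{0}.J a) :=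
  fun _ => inferInstanceAs (IsEmpty PEmpty)

/-- **The telecore family `𝒥`** of the twisted telecore: the twisted family on the pairs through `Anab`
(Def. 3.5 (iv) (b)). [cite: MochizukiAbsTopIII2015, Definition 3.5 (iv) p.76] -/
def jfam : (TD τ).HomotopyFamily :=
  tFamily τ (univE (· = (teleShape anJ.{0}).obs)) (isSaturated_univE _)

/-- Weights agree along `𝒟_{≤5} ∪ {Anab} ↪ 𝒟` and `↪ 𝒟_An`: edges. [cite: MochizukiAbsTopIII2015, Corollary 3.6 (ii) p.79] -/
private theorem tEdgeWt_incl : ∀ {a b : coreShape5.{0}.Vertex} (e : a ⟶ b),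
    tEdgeWt ((telecoreInclusion coreShape5.{0} coreShape5_isEmpty_J'' anJ.{0}).map e) =
      edgeWt (embCore5.map e) := by
  intro a b e
  cases a with
  | obs => cases b <;> exact PEmpty.elim e
  | base α =>
    obtain ⟨α, hα⟩ := α
    cases b with
    | obs => cases α <;> first | exact PEmpty.elim e | rfl
    | base β =>
      obtain ⟨β, hβ⟩ := β
      cases α <;> cases β <;> first | exact PEmpty.elim e | rfl

/-- Weights agree along `𝒟_{≤5} ∪ {Anab} ↪ 𝒟` and `↪ 𝒟_An`: paths. [cite: MochizukiAbsTopIII2015, Corollary 3.6 (ii) p.79] -/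
private theorem tPathWt_incl {a b : coreShape5.{0}.Vertex} (p : Path a b) :
    tPathWt ((telecoreInclusion coreShape5.{0} coreShape5_isEmpty_J'' anJ.{0}).mapPath p) =
      pathWt (embCore5.mapPath p) := by
  induction p with
  | nil => rw [Prefunctor.mapPath_nil, Prefunctor.mapPath_nil, pathWt]; erw [tPathWt_nil]
  | cons p e ih =>
    rw [Prefunctor.mapPath_cons, Prefunctor.mapPath_cons, pathWt, ← ih, ← tEdgeWt_incl e]
    erw [tPathWt_cons]

/-- A natural transformation into `Anab = B(ℤ/2)` is determined, up to `HEq` along equal functors, by the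
underlying elements of its components. [folklore] -/
private theorem natTrans_heq_of_val_obs {C : Type} [Category C] {F G F' G' : C ⥤ Cat}
    (hF : F = F') (hG : G = G') (α : F ⟶ G) (β : F' ⟶ G')
    (happ : ∀ X, (α.app X : Grp) = (β.app X : Grp)) : HEq α β := by
  subst hF hG
  rw [heq_iff_eq]
  ext X
  exact happ X

/-- `𝒟_{[embCore5 γ]} ≍ (𝒟_An)_{[incl γ]}` (both are the path functor of `γ` in `𝒟_{≤5} ∪ {Anab}`; abc-iut-L4-t5's
`core5Diagram_eq_comapAlong`, `pathFunctor_telecoreInclusion`). [cite: MochizukiAbsTopIII2015, Definition 3.5 (iv) p.76] -/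
private theorem pathFunctor_embCore5_heq_incl {a b : coreShape5.{0}.Vertex} (p : Path a b) :
    HEq (datum.diagram.pathFunctor (embCore5.mapPath p))
      ((TD τ).pathFunctor ((telecoreInclusion coreShape5.{0} coreShape5_isEmpty_J'' anJ.{0}).mapPath p)) :=
  ((heq_of_eq (datum.diagram.pathFunctor_comapAlong embCore5 p)).symm.trans
    (pathFunctor_heq_of_eq datum.core5Diagram_eq_comapAlong.symm p)).trans
    ((datum.sub 4).pathFunctor_telecoreInclusion (datum.coreObs5 (datum.coreFamily5Of family) (fun _ _ _ _ h => h.1))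
      anJ (datum.anTelMap τ) p)

/-- **The telecore `𝔗_An` of the printed shape OVER THE TWISTED CORE**: telecore edges `φ_⋏` (`⋏ ∈ L†`)
carrying `φ_An` / `φ_⋎`, telecore family `𝒥` = the twisted family on the pairs through `Anab`, which restricts
to the twisted core family on `(𝒟_{≤5}, Anab)`. [cite: MochizukiAbsTopIII2015, Corollary 3.6 (ii) p.79] -/
def telecore : (datum.sub 4).Telecore (datum.coreObs5 (datum.coreFamily5Of family) (fun _ _ _ _ h => h.1)) isCore5 where
  J := anJ
  telMap j := datum.anTelMap τ j
  Jfam := jfam τ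
  boundary_iff := by intro a b p q; exact univE_obs_iff p q
  pathFunctor_incl := by
    intro a b p
    exact (datum.sub 4).pathFunctor_telecoreInclusion
      (datum.coreObs5 (datum.coreFamily5Of family) (fun _ _ _ _ h => h.1)) anJ (datum.anTelMap τ) p
  restrict_E := by
    intro a b p q
    constructor
    · rintro ⟨rfl, -⟩
      exact univE_of_mem (· = (teleShape anJ.{0}).obs) rfl _ _
    · rintro ⟨d⟩
      obtain ⟨w, hw, p₁, q₁, s, hp, hq⟩ := d
      subst hw
      have hb : b = coreShape5.{0}.obs := eq_obs_of_mapPath_eq_comp coreShape5 coreShape5_isEmpty_J'' anJ p p₁ s hp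
      subst hb
      exact ⟨rfl, (datum.pullCore5_E_iff family p q).mpr
        (datum.glueE_of_coreVertices (Or.inr (Or.inl rfl)) (embCore5.mapPath p) (embCore5.mapPath q))⟩
  restrict_η := by
    intro a b p q h
    obtain ⟨hb, h₂⟩ := h
    subst hb
    obtain ⟨h', hh⟩ := datum.pullCore5_compatibleAlong family p q h₂
    refine hh.trans ?_
    show HEq (eta (embCore5.mapPath p) (embCore5.mapPath q)) (tEta τ _ _)
    cases a with
    | obs =>
      exact natTrans_heq_of_val_obs (eq_of_heq (pathFunctor_embCore5_heq_incl τ p))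
        (eq_of_heq (pathFunctor_embCore5_heq_incl τ q)) _ _ (fun X =>
          congrArg₂ (fun u v : ZMod 2 => (Multiplicative.ofAdd (u - v) : Grp))
            (tPathWt_incl q).symm (tPathWt_incl p).symm)
    | base α =>
      obtain ⟨α, hα⟩ := α
      cases α <;>
      exact natTrans_heq_of_val_obs (eq_of_heq (pathFunctor_embCore5_heq_incl τ p))
        (eq_of_heq (pathFunctor_embCore5_heq_incl τ q)) _ _ (fun X =>
          congrArg₂ (fun u v : ZMod 2 => (Multiplicative.ofAdd (u - v) : Grp))
            (tPathWt_incl q).symm (tPathWt_incl p).symm)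

/-- The twisted telecore has the printed shape. [cite: MochizukiAbsTopIII2015, Corollary 3.6 (ii) p.79] -/
theorem telecore_isTelecoreAn : datum.IsTelecoreAn τ (telecore τ) where
  edges_iff a := by
    obtain ⟨a, ha⟩ := a
    cases a with
    | row1 n => exact ⟨fun _ => by simp [LFVertex.row], fun _ => ⟨PUnit.unit⟩⟩
    | nexus => exact ⟨fun _ => by simp [LFVertex.row], fun _ => ⟨PUnit.unit⟩⟩
    | third => exact ⟨fun ⟨j⟩ => PEmpty.elim j, fun h => by simp [LFVertex.row] at h⟩
    | fourth => exact ⟨fun ⟨j⟩ => PEmpty.elim j, fun h => by simp [LFVertex.row] at h⟩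
    | fifth => exact (not_fifth_le_four ha).elim
    | sixth => exact ⟨fun ⟨j⟩ => PEmpty.elim j, fun h => by simp [LFVertex.row] at h⟩
  edges_subsingleton a := by
    obtain ⟨a, ha⟩ := a
    cases a with
    | row1 n => exact inferInstanceAs (Subsingleton PUnit)
    | nexus => exact inferInstanceAs (Subsingleton PUnit)
    | third => exact inferInstanceAs (Subsingleton PEmpty)
    | fourth => exact inferInstanceAs (Subsingleton PEmpty)
    | fifth => exact inferInstanceAs (Subsingleton PEmpty)
    | sixth => exact inferInstanceAs (Subsingleton PEmpty)
  telMap_nexus _ _ := rfl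
  telMap_row1 _ _ _ := rfl

end TwistedToy

end LogFrobeniusData

end Literature.AnabelianGeometry.AbsoluteAnabelian
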